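import Mathlib
import Summits.NavierStokesRegularity.NavierStokesRegularity.Theorems.L3TimeExponentPincerJawFullMorrey
import HarnessLib.Audit
import HarnessLib

/-!
# `L3TimeExponentPincer` — THEOREM J″: the MORREY-RATE form of theorem J′

Bears on the parent crux `stmt-NavierStokesRegularity-19499` (`…Theses.L3TimeExponentPincer.L3CascadeJaw`:
`∫_{T₂}^{T} ‖u(t)‖₃^q dt < ∞` for every `q ∈ (4,5)` and every frame solution).  Helper file (cell seat
nsreg-p2, ROUND-9 Addendum A); it extends `…Theorems.L3TimeExponentPincerJawFullMorrey` (theorem J′, which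
decides the clause on the FULL-Morrey-Type-I class `FullMorreyTypeINear`, i.e. scaled energy `A ≤ M` on all late
cylinders) to blow-ups whose scaled energy is allowed to GROW in time:

* `MorreyRateNear u T Φ`: `∫_{B(x₀,r)} |u(t)|² ≤ Φ(t) · r` for all late `t`, all centres, all `0 < r < r₁`,
  with a time-dependent Morrey level `Φ : ℝ → ℝ≥0`.
* `jaw_of_morreyRate` (**J″**): if `Φ` is measurable and `∫_{T₁}^{T} Φ(t)^{q/(6-q)} dt < ∞` then
  `∫_{T₂}^{T} ‖u(t)‖₃^q dt < ∞` (`0 < q < 6`), modulo the `W^{1,1}` trace inequality `MazyaTraceW11`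
  (which follows from the literature fact `Literature.Analysis.FunctionSpaces.MazyaTraceD`).
  Mechanism: the slice inequality of J′ with a time-dependent growth constant,
  `‖u(t)‖₃³ ≤ c · growthConst(Φ(t)+1, e₀, r₁) · 2√e₀ · ‖∇u(t)‖₂`, then Young's inequality in time with the
  conjugate pair `(6/(6-q), 6/q)` against the finite dissipation `∫‖∇u‖₂² < ∞`.
* `jaw_of_morreyPowerRate`: the power-law case `Φ(t) = M (T-t)^{-β}`: the clause holds for `q` whenever
  `β q < 6 - q`; in particular (`l3CascadeJaw_clause_of_morreyPowerRate`) a frame blow-up whose scaled energies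
  grow at most like `(T-t)^{-1/5}` satisfies the FULL `L3CascadeJaw` clause (every `q ∈ (4,5)`).

So a counterexample to `L3CascadeJaw` must be «Morrey-Type-II at rate worse than `(T-t)^{-1/5}`» in the
`L^{q/(6-q)}`-integrated sense — the quantitative form of the open remainder recorded in J′.
No hard core (`NoTypeII`, Liouville theorems) is used.  0 sorry.
-/

noncomputable section

namespace Summit.NavierStokesRegularity.NavierStokesRegularity.Theorems.L3TimeExponentPincerJawMorreyRate

open MeasureTheory Set Function Filter Metric Topology
open scoped ENNReal NNReal
open Literature.Analysis.FluidPDE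
open Summit.NavierStokesRegularity.NavierStokesRegularity.Theorems.L3TimeExponentPincerMorreyGrowth
open Summit.NavierStokesRegularity.NavierStokesRegularity.Theorems.L3TimeExponentPincerJawFullMorrey
open Literature.Analysis.FunctionSpaces (MazyaTraceD)

/-- **Morrey rate near `T`**: `∫_{B(x₀,r)} |u(t)|² ≤ Φ(t) r` for all late `t`, all centres, all `0 < r < r₁`. -/
def MorreyRateNear (u : ℝ → (EuclideanSpace ℝ (Fin 3)) → (EuclideanSpace ℝ (Fin 3))) (T : ℝ) (Φ : ℝ → ℝ≥0) : Prop :=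
  ∃ r₁ : ℝ, 0 < r₁ ∧ ∃ T₁ < T, ∀ t ∈ Ioo T₁ T, ∀ x₀ : (EuclideanSpace ℝ (Fin 3)), ∀ r : ℝ, 0 < r → r < r₁ →
    ∫⁻ x in ball x₀ r, ‖u t x‖ₑ ^ 2 ≤ ENNReal.ofReal ((Φ t : ℝ) * r)

/-- The full-Morrey-Type-I class is the constant-rate case. -/
theorem morreyRateNear_const_of_full {u : ℝ → (EuclideanSpace ℝ (Fin 3)) → (EuclideanSpace ℝ (Fin 3))} {T : ℝ}
    (h : FullMorreyTypeINear u T) : ∃ M : ℝ≥0, MorreyRateNear u T (fun _ => M) := by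
  obtain ⟨M, hM, r₁, hr₁, T₁, hT₁, hMor⟩ := h
  refine ⟨M.toNNReal, r₁, hr₁, T₁, hT₁, fun t ht x₀ r hr hrr => (hMor t ht x₀ r hr hrr).trans (le_of_eq ?_)⟩
  rw [Real.coe_toNNReal _ hM.le]

/-- `(x+1)^a ≤ 2^a (x^a + 1)` in `ℝ≥0∞` for `0 ≤ a`. -/
theorem add_one_rpow_le (x : ℝ≥0∞) {a : ℝ} (ha : 0 ≤ a) : (x + 1) ^ a ≤ (2 : ℝ≥0∞) ^ a * (x ^ a + 1) := by
  rcases le_total x 1 with hx | hx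
  · calc (x + 1) ^ a ≤ (1 + 1 : ℝ≥0∞) ^ a := ENNReal.rpow_le_rpow (add_le_add hx le_rfl) ha
      _ = 2 ^ a := by norm_num
      _ ≤ 2 ^ a * (x ^ a + 1) := le_mul_of_one_le_right bot_le le_add_self
  · calc (x + 1) ^ a ≤ (x + x) ^ a := ENNReal.rpow_le_rpow (add_le_add le_rfl hx) ha
      _ = (2 * x) ^ a := by rw [two_mul]
      _ = 2 ^ a * x ^ a := ENNReal.mul_rpow_of_nonneg _ _ ha
      _ ≤ 2 ^ a * (x ^ a + 1) := by gcongr; exact le_self_add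

/-- `x / ofReal r ≤ x` for `1 ≤ r`. -/
theorem div_ofReal_le_self (x : ℝ≥0∞) {r : ℝ} (hr : 1 ≤ r) : x / ENNReal.ofReal r ≤ x :=
  ENNReal.div_le_of_le_mul (le_mul_of_one_le_right bot_le (ENNReal.one_le_ofReal.2 hr))

/-- **THEOREM J″ (Morrey-rate jaw).**  `MorreyRateNear u T Φ` with `Φ` measurable and
`∫_{T₁}^{T} Φ^{q/(6-q)} < ∞` gives `∫_{T₂}^{T} ‖u(t)‖₃^q dt < ∞` (`0 < q < 6`), modulo `MazyaTraceW11`. -/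
theorem jaw_of_morreyRate (hMZ : MazyaTraceW11) {ν T : ℝ} (hν : 0 < ν) (hT : 0 < T)
    {u : ℝ → (EuclideanSpace ℝ (Fin 3)) → (EuclideanSpace ℝ (Fin 3))} {p : ℝ → (EuclideanSpace ℝ (Fin 3)) → ℝ}
    (hcl : IsClassicalNSSolutionOn (Ico 0 T) ν 0 u p) (hLH : IsLerayHopfOn T ν 0 (u 0) u)
    {Φ : ℝ → ℝ≥0} (hΦm : Measurable Φ) (hΦ : MorreyRateNear u T Φ) {q : ℝ} (hq0 : 0 < q) (hq6 : q < 6)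
    (hint : ∃ T₁' < T, ∫⁻ t in Ioo T₁' T, (Φ t : ℝ≥0∞) ^ (q / (6 - q)) < ⊤) :
    ∃ T₂ ∈ Ioo 0 T, (∫⁻ t in Ioo T₂ T, eLpNorm (u t) 3 volume ^ q) < ⊤ := by
  obtain ⟨c, hc⟩ := lintegral_cube_le hMZ
  obtain ⟨r₁, hr₁, T₁, hT₁, hMor⟩ := hΦ
  obtain ⟨T₁', hT₁', hint⟩ := hint
  set e₀ : ℝ := 2 * VectorCalculus.kineticEnergy (u 0) with he₀
  have he₀nn : 0 ≤ e₀ := mul_nonneg zero_le_two (kineticEnergy_nonneg _)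
  set T₂ : ℝ := max (max T₁ T₁') (T / 2) with hT₂
  have hT₂mem : T₂ ∈ Ioo 0 T :=
    ⟨lt_max_of_lt_right (by linarith), max_lt (max_lt hT₁ hT₁') (by linarith)⟩
  -- exponents
  have h6q : 0 < 6 - q := by linarith
  set a : ℝ := q / (6 - q) with ha
  set s : ℝ := 2 * q / (6 - q) with hs
  have ha0 : 0 < a := div_pos hq0 h6q
  have hs0 : 0 < s := by positivity
  have hq3 : 0 ≤ q / 3 := by positivity
  have hα : 0 < (6 - q) / 6 := by positivity
  have hβ : 0 < q / 6 := by positivity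
  have hconj : (1 / ((6 - q) / 6)).HolderConjugate (1 / (q / 6)) :=
    Real.holderConjugate_one_div hα hβ (by ring)
  have hp1 : 1 ≤ 1 / ((6 - q) / 6) := one_le_one_div hα (by linarith)
  have hp2 : 1 ≤ 1 / (q / 6) := one_le_one_div hβ (by linarith)
  have hexp1 : q / 3 * (1 / ((6 - q) / 6)) = s := by
    rw [hs]; field_simp; ring
  have hexp2 : q / 6 * (1 / (q / 6)) = 1 := by field_simp
  have hexp3 : (1 / 2 : ℝ) * s = a := by
    rw [hs, ha]; field_simp
  have hexp4 : (1 / 2 : ℝ) * (q / 3) = q / 6 := by ring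
  -- constants
  set B : ℝ≥0∞ := 2 * (ENNReal.ofReal e₀) ^ (1 / 2 : ℝ) with hB
  set C₁ : ℝ := Real.sqrt V₁ * (1 + Real.sqrt (e₀ / r₁)) with hC₁
  have hC₁nn : 0 ≤ C₁ := by positivity
  set L : ℝ≥0∞ := ((c : ℝ≥0∞) * ENNReal.ofReal C₁ * B) ^ s * (2 : ℝ≥0∞) ^ a with hL
  have hBtop : B ≠ ⊤ :=
    ENNReal.mul_ne_top (by norm_num) (ENNReal.rpow_ne_top_of_nonneg (by norm_num) ENNReal.ofReal_ne_top)
  have hLtop : L ≠ ⊤ := by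
    refine ENNReal.mul_ne_top (ENNReal.rpow_ne_top_of_nonneg hs0.le ?_)
      (ENNReal.rpow_ne_top_of_nonneg ha0.le (by norm_num))
    exact ENNReal.mul_ne_top (ENNReal.mul_ne_top ENNReal.coe_ne_top ENNReal.ofReal_ne_top) hBtop
  -- the pointwise bound at late times
  have hpt : ∀ t ∈ Ioo T₂ T,
      eLpNorm (u t) 3 volume ^ q ≤ L * ((Φ t : ℝ≥0∞) ^ a + 1) + dissipRate u t := by
    intro t ht
    have htT₁ : T₁ < t := lt_of_le_of_lt ((le_max_left _ _).trans (le_max_left _ _)) ht.1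
    have ht0 : 0 < t := hT₂mem.1.trans ht.1
    have htc : t ∈ Ico 0 T := ⟨ht0.le, ht.2⟩
    have hE : ∫⁻ y, ‖u t y‖ₑ ^ 2 ≤ ENNReal.ofReal e₀ := hLH.lintegral_enorm_sq_le hν.le ⟨ht0.le, ht.2.le⟩
    have hΦnn : 0 ≤ (Φ t : ℝ) := (Φ t).coe_nonneg
    have hMpos : 0 < (Φ t : ℝ) + 1 := by linarith
    have h1 := hc (u t) (hcl.contDiff_velocity htc) ((Φ t : ℝ) + 1) e₀ r₁ hMpos he₀nn hr₁ hE
      (fun x₀ r hr hrr => (hMor t ⟨htT₁, ht.2⟩ x₀ r hr hrr).trans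
        (ENNReal.ofReal_le_ofReal (by nlinarith)))
    -- the growth constant against `√(Φ+1)`
    have hG_le : (growthConst ((Φ t : ℝ) + 1) e₀ r₁ : ℝ≥0∞) ≤
        ENNReal.ofReal C₁ * ((Φ t : ℝ≥0∞) + 1) ^ (1 / 2 : ℝ) := by
      have hφ1 : ((Φ t : ℝ≥0∞) + 1) = ENNReal.ofReal ((Φ t : ℝ) + 1) := by
        rw [ENNReal.ofReal_add hΦnn zero_le_one, ENNReal.ofReal_coe_nnreal, ENNReal.ofReal_one]
      rw [coe_growthConst, hφ1, ENNReal.ofReal_rpow_of_nonneg hMpos.le (by norm_num),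
        ← ENNReal.ofReal_mul hC₁nn, ← Real.sqrt_eq_rpow]
      refine ENNReal.ofReal_le_ofReal ?_
      have hsq1 : 1 ≤ Real.sqrt ((Φ t : ℝ) + 1) := Real.one_le_sqrt.2 (by linarith)
      have hx : Real.sqrt ((Φ t : ℝ) + 1) + Real.sqrt (e₀ / r₁) ≤
          (1 + Real.sqrt (e₀ / r₁)) * Real.sqrt ((Φ t : ℝ) + 1) := by
        nlinarith [Real.sqrt_nonneg (e₀ / r₁), hsq1]
      calc Real.sqrt V₁ * (Real.sqrt ((Φ t : ℝ) + 1) + Real.sqrt (e₀ / r₁))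
          ≤ Real.sqrt V₁ * ((1 + Real.sqrt (e₀ / r₁)) * Real.sqrt ((Φ t : ℝ) + 1)) :=
            mul_le_mul_of_nonneg_left hx (Real.sqrt_nonneg _)
        _ = C₁ * Real.sqrt ((Φ t : ℝ) + 1) := by rw [hC₁]; ring
    -- `∫|u(t)|³ ≤ (c C₁ B) (Φ+1)^{1/2} δ^{1/2}`
    have hX : ∫⁻ y, ‖u t y‖ₑ ^ (3 : ℕ) ≤
        ((c : ℝ≥0∞) * ENNReal.ofReal C₁ * B) * ((Φ t : ℝ≥0∞) + 1) ^ (1 / 2 : ℝ) *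
          (dissipRate u t) ^ (1 / 2 : ℝ) := by
      calc ∫⁻ y, ‖u t y‖ₑ ^ (3 : ℕ)
          ≤ (c : ℝ≥0∞) * (growthConst ((Φ t : ℝ) + 1) e₀ r₁ : ℝ≥0∞) * (B * (dissipRate u t) ^ (1 / 2 : ℝ)) := h1
        _ ≤ (c : ℝ≥0∞) * (ENNReal.ofReal C₁ * ((Φ t : ℝ≥0∞) + 1) ^ (1 / 2 : ℝ)) *
              (B * (dissipRate u t) ^ (1 / 2 : ℝ)) := by gcongr
        _ = _ := by ring
    -- raise to the power `q/3`
    have hXq : eLpNorm (u t) 3 volume ^ q ≤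
        (((c : ℝ≥0∞) * ENNReal.ofReal C₁ * B) * ((Φ t : ℝ≥0∞) + 1) ^ (1 / 2 : ℝ)) ^ (q / 3) *
          (dissipRate u t) ^ (q / 6) := by
      rw [eLpNorm_three_rpow_eq]
      calc (∫⁻ y, ‖u t y‖ₑ ^ (3 : ℕ)) ^ (q / 3)
          ≤ (((c : ℝ≥0∞) * ENNReal.ofReal C₁ * B) * ((Φ t : ℝ≥0∞) + 1) ^ (1 / 2 : ℝ) *
              (dissipRate u t) ^ (1 / 2 : ℝ)) ^ (q / 3) := ENNReal.rpow_le_rpow hX hq3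
        _ = _ := by rw [ENNReal.mul_rpow_of_nonneg _ _ hq3, ← ENNReal.rpow_mul, hexp4]
    -- Young in time-pointwise form: `a b ≤ a^{6/(6-q)} + b^{6/q}`
    have hY := ENNReal.young_inequality
      ((((c : ℝ≥0∞) * ENNReal.ofReal C₁ * B) * ((Φ t : ℝ≥0∞) + 1) ^ (1 / 2 : ℝ)) ^ (q / 3))
      ((dissipRate u t) ^ (q / 6)) hconj
    have hKP : ((((c : ℝ≥0∞) * ENNReal.ofReal C₁ * B) * ((Φ t : ℝ≥0∞) + 1) ^ (1 / 2 : ℝ)) ^ (q / 3)) ^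
        (1 / ((6 - q) / 6)) ≤ L * ((Φ t : ℝ≥0∞) ^ a + 1) := by
      rw [← ENNReal.rpow_mul, hexp1, ENNReal.mul_rpow_of_nonneg _ _ hs0.le, ← ENNReal.rpow_mul, hexp3, hL]
      calc ((c : ℝ≥0∞) * ENNReal.ofReal C₁ * B) ^ s * ((Φ t : ℝ≥0∞) + 1) ^ a
          ≤ ((c : ℝ≥0∞) * ENNReal.ofReal C₁ * B) ^ s * ((2 : ℝ≥0∞) ^ a * ((Φ t : ℝ≥0∞) ^ a + 1)) := by
            gcongr; exact add_one_rpow_le _ ha0.le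
        _ = _ := (mul_assoc _ _ _).symm
    have hD : ((dissipRate u t) ^ (q / 6)) ^ (1 / (q / 6)) = dissipRate u t := by
      rw [← ENNReal.rpow_mul, hexp2, ENNReal.rpow_one]
    calc eLpNorm (u t) 3 volume ^ q
        ≤ _ := hXq
      _ ≤ _ := hY
      _ ≤ ((((c : ℝ≥0∞) * ENNReal.ofReal C₁ * B) * ((Φ t : ℝ≥0∞) + 1) ^ (1 / 2 : ℝ)) ^ (q / 3)) ^
              (1 / ((6 - q) / 6)) + ((dissipRate u t) ^ (q / 6)) ^ (1 / (q / 6)) :=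
          add_le_add (div_ofReal_le_self _ hp1) (div_ofReal_le_self _ hp2)
      _ ≤ L * ((Φ t : ℝ≥0∞) ^ a + 1) + dissipRate u t := by rw [hD]; exact add_le_add hKP le_rfl
  -- integrate in time
  refine ⟨T₂, hT₂mem, ?_⟩
  have hdiss : ∫⁻ t in Ioo 0 T, dissipRate u t < ⊤ := dissip_lt_top hcl hLH
  have hmΦa : Measurable fun t => (Φ t : ℝ≥0∞) ^ a := hΦm.coe_nnreal_ennreal.pow_const a
  have hmF : Measurable fun t => L * ((Φ t : ℝ≥0∞) ^ a + 1) := (hmΦa.add_const 1).const_mul L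
  have hT₁'T₂ : T₁' ≤ T₂ := (le_max_right T₁ T₁').trans (le_max_left _ _)
  calc ∫⁻ t in Ioo T₂ T, eLpNorm (u t) 3 volume ^ q
      ≤ ∫⁻ t in Ioo T₂ T, (L * ((Φ t : ℝ≥0∞) ^ a + 1) + dissipRate u t) :=
        setLIntegral_mono' measurableSet_Ioo hpt
    _ = (∫⁻ t in Ioo T₂ T, L * ((Φ t : ℝ≥0∞) ^ a + 1)) + ∫⁻ t in Ioo T₂ T, dissipRate u t :=
        lintegral_add_left hmF _
    _ = L * ((∫⁻ t in Ioo T₂ T, (Φ t : ℝ≥0∞) ^ a) + ∫⁻ t in Ioo T₂ T, (1 : ℝ≥0∞)) +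
          ∫⁻ t in Ioo T₂ T, dissipRate u t := by
        rw [lintegral_const_mul L (hmΦa.add_const 1), lintegral_add_left hmΦa]
    _ < ⊤ := by
        refine ENNReal.add_lt_top.2 ⟨ENNReal.mul_lt_top hLtop.lt_top (ENNReal.add_lt_top.2 ⟨?_, ?_⟩), ?_⟩
        · exact lt_of_le_of_lt (lintegral_mono_set (Ioo_subset_Ioo_left hT₁'T₂)) hint
        · rw [setLIntegral_const, Real.volume_Ioo]
          exact ENNReal.mul_lt_top ENNReal.one_lt_top ENNReal.ofReal_lt_top
        · exact lt_of_le_of_lt (lintegral_mono_set (Ioo_subset_Ioo_left hT₂mem.1.le)) hdiss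

/-- **J″ from the literature fact** `MazyaTraceD` (Maz'ya 1985 §1.4.2 Thm 2). -/
theorem jaw_of_morreyRate_mazya (hMZ : MazyaTraceD) {ν T : ℝ} (hν : 0 < ν) (hT : 0 < T)
    {u : ℝ → (EuclideanSpace ℝ (Fin 3)) → (EuclideanSpace ℝ (Fin 3))} {p : ℝ → (EuclideanSpace ℝ (Fin 3)) → ℝ}
    (hcl : IsClassicalNSSolutionOn (Ico 0 T) ν 0 u p) (hLH : IsLerayHopfOn T ν 0 (u 0) u)
    {Φ : ℝ → ℝ≥0} (hΦm : Measurable Φ) (hΦ : MorreyRateNear u T Φ) {q : ℝ} (hq0 : 0 < q) (hq6 : q < 6)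
    (hint : ∃ T₁' < T, ∫⁻ t in Ioo T₁' T, (Φ t : ℝ≥0∞) ^ (q / (6 - q)) < ⊤) :
    ∃ T₂ ∈ Ioo 0 T, (∫⁻ t in Ioo T₂ T, eLpNorm (u t) 3 volume ^ q) < ⊤ :=
  jaw_of_morreyRate (mazyaTraceW11_of_D hMZ) hν hT hcl hLH hΦm hΦ hq0 hq6 hint

/-! ### The power-law rate `Φ(t) = M (T-t)^{-β}` -/

/-- `∫_{T₂}^{T} (T-t)^{-γ} dt < ∞` for `γ < 1` (as a lower Lebesgue integral of `ofReal`). -/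
theorem lintegral_Ioo_rpow_neg_lt_top {T₂ T k γ : ℝ} (hT₂ : T₂ < T) (hγ : γ < 1) :
    ∫⁻ t in Ioo T₂ T, ENNReal.ofReal (k * (T - t) ^ (-γ)) < ⊤ := by
  have h := (intervalIntegral.intervalIntegrable_rpow' (a := 0) (b := T - T₂)
    (by linarith : -1 < -γ)).comp_sub_left T
  rw [sub_zero, sub_sub_cancel] at h
  have h' : IntegrableOn (fun t : ℝ => k * (T - t) ^ (-γ)) (Ioo T₂ T) :=
    ((intervalIntegrable_iff_integrableOn_Ioo_of_le hT₂.le).1 h.symm).const_mul _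
  calc ∫⁻ t in Ioo T₂ T, ENNReal.ofReal (k * (T - t) ^ (-γ))
      ≤ ∫⁻ t in Ioo T₂ T, ‖k * (T - t) ^ (-γ)‖ₑ := lintegral_ofReal_le_lintegral_enorm _
    _ < ⊤ := h'.2

/-- **Power-law Morrey rate**: scaled energies growing at most like `M (T-t)^{-β}` give the clause for every
`0 < q < 6` with `β q < 6 - q`, i.e. `β < (6-q)/q` (modulo `MazyaTraceW11`; `β ≤ 0` = the full-Morrey class). -/
theorem jaw_of_morreyPowerRate (hMZ : MazyaTraceW11) {ν T : ℝ} (hν : 0 < ν) (hT : 0 < T)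
    {u : ℝ → (EuclideanSpace ℝ (Fin 3)) → (EuclideanSpace ℝ (Fin 3))} {p : ℝ → (EuclideanSpace ℝ (Fin 3)) → ℝ}
    (hcl : IsClassicalNSSolutionOn (Ico 0 T) ν 0 u p) (hLH : IsLerayHopfOn T ν 0 (u 0) u)
    {M β r₁ T₁ : ℝ} (hM : 0 ≤ M) (hr₁ : 0 < r₁) (hT₁ : T₁ < T)
    (hMor : ∀ t ∈ Ioo T₁ T, ∀ x₀ : (EuclideanSpace ℝ (Fin 3)), ∀ r : ℝ, 0 < r → r < r₁ →
      ∫⁻ x in ball x₀ r, ‖u t x‖ₑ ^ 2 ≤ ENNReal.ofReal (M * (T - t) ^ (-β) * r))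
    {q : ℝ} (hq0 : 0 < q) (hq6 : q < 6) (hβq : β * q < 6 - q) :
    ∃ T₂ ∈ Ioo 0 T, (∫⁻ t in Ioo T₂ T, eLpNorm (u t) 3 volume ^ q) < ⊤ := by
  have h6q : 0 < 6 - q := by linarith
  set Φ : ℝ → ℝ≥0 := fun t => (M * (T - t) ^ (-β)).toNNReal with hΦ
  have hΦm : Measurable Φ :=
    (measurable_const.mul ((measurable_const.sub measurable_id).pow_const _)).real_toNNReal
  have hΦval : ∀ t, t < T → (Φ t : ℝ) = M * (T - t) ^ (-β) := fun t ht => by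
    rw [hΦ]
    exact Real.coe_toNNReal _ (mul_nonneg hM (Real.rpow_nonneg (by linarith) _))
  have hrate : MorreyRateNear u T Φ :=
    ⟨r₁, hr₁, T₁, hT₁, fun t ht x₀ r hr hrr => by rw [hΦval t ht.2]; exact hMor t ht x₀ r hr hrr⟩
  refine jaw_of_morreyRate hMZ hν hT hcl hLH hΦm hrate hq0 hq6 ⟨T₁, hT₁, ?_⟩
  -- `∫ Φ^{q/(6-q)} = ∫ M^{a} (T-t)^{-β a} < ∞` since `β a < 1`
  have ha0 : 0 < q / (6 - q) := div_pos hq0 h6q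
  have hγ : β * (q / (6 - q)) < 1 := by rw [← mul_div_assoc, div_lt_one h6q]; exact hβq
  have hpt : ∀ t ∈ Ioo T₁ T, (Φ t : ℝ≥0∞) ^ (q / (6 - q)) =
      ENNReal.ofReal (M ^ (q / (6 - q)) * (T - t) ^ (-(β * (q / (6 - q))))) := by
    intro t ht
    have hTt : 0 < T - t := by linarith [ht.2]
    rw [← ENNReal.ofReal_coe_nnreal, hΦval t ht.2, ENNReal.ofReal_rpow_of_nonneg (by
      exact mul_nonneg hM (Real.rpow_nonneg hTt.le _)) ha0.le,
      Real.mul_rpow hM (Real.rpow_nonneg hTt.le _), ← Real.rpow_mul hTt.le, neg_mul]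
  calc ∫⁻ t in Ioo T₁ T, (Φ t : ℝ≥0∞) ^ (q / (6 - q))
      = ∫⁻ t in Ioo T₁ T, ENNReal.ofReal (M ^ (q / (6 - q)) * (T - t) ^ (-(β * (q / (6 - q))))) :=
        setLIntegral_congr_fun measurableSet_Ioo hpt
    _ < ⊤ := lintegral_Ioo_rpow_neg_lt_top hT₁ hγ

/-- **The `L3CascadeJaw` clause under a `(T-t)^{-1/5}` Morrey rate**: every `q ∈ (4,5)`, hence the whole
clause of the parent crux, for frame solutions whose scaled energies grow at most like `(T-t)^{-1/5}`
(modulo the literature fact `MazyaTraceD`; the decay hypothesis of the route clause is not needed). -/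
theorem l3CascadeJaw_clause_of_morreyPowerRate (hMZ : MazyaTraceD) (q : ℝ) (hq4 : 4 < q) (hq5 : q < 5)
    (ν T : ℝ) (hν : 0 < ν) (hT : 0 < T)
    (u : ℝ → (EuclideanSpace ℝ (Fin 3)) → (EuclideanSpace ℝ (Fin 3))) (p : ℝ → (EuclideanSpace ℝ (Fin 3)) → ℝ)
    (hcl : IsClassicalNSSolutionOn (Ico 0 T) ν 0 u p) (hLH : IsLerayHopfOn T ν 0 (u 0) u)
    {M β r₁ T₁ : ℝ} (hM : 0 ≤ M) (hβ : β ≤ 1 / 5) (hr₁ : 0 < r₁) (hT₁ : T₁ < T)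
    (hMor : ∀ t ∈ Ioo T₁ T, ∀ x₀ : (EuclideanSpace ℝ (Fin 3)), ∀ r : ℝ, 0 < r → r < r₁ →
      ∫⁻ x in ball x₀ r, ‖u t x‖ₑ ^ 2 ≤ ENNReal.ofReal (M * (T - t) ^ (-β) * r)) :
    ∃ T₂ ∈ Ioo 0 T, (∫⁻ t in Ioo T₂ T, eLpNorm (u t) 3 volume ^ q) < ⊤ :=
  jaw_of_morreyPowerRate (mazyaTraceW11_of_D hMZ) hν hT hcl hLH hM hr₁ hT₁ hMor (by linarith) (by linarith)
    (by nlinarith)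

end Summit.NavierStokesRegularity.NavierStokesRegularity.Theorems.L3TimeExponentPincerJawMorreyRate
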